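import Literature.NumberTheory.EllipticCurves.UniversalSigmaSpecializationProofs
import HarnessLib

/-!
# The analytic half of Blakestad–Grant's Prop. 13 and the assembly of their Thm. 1:
# `mazur_tate_sigma_existsUnique` from the data of a Frobenius `p`-isogeny (proofs only)

Trunk T-NT-EC (Literature/NumberTheory/EllipticCurves). After `UniversalSigmaSpecializationProofs`
the existence half of the named fact `WeierstrassCurve.mazur_tate_sigma_existsUnique`
(Mazur–Stein–Tate 2006, Thm. 1.3) is Blakestad–Grant's Thm. 1 over `R̂` (J. Number Theory 249
(2023), arXiv:1903.02480): `exp(g) ∈ R̂⟦t⟧` for `g = ∫ζ̃ω`. Their proof has a GEOMETRIC part —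
Prop. 7 (the quotient `𝓔' = 𝓔/𝒢` of the universal ordinary curve by its canonical subgroup, in the
model `E'_{p/H}` with coefficients `A'ᵢ ≡ Aᵢᵖ (mod p)`, and the parameter `t' ≡ tᵖ (mod p)` of
the isogeny `ψ`), Lemma 10 (a group-law identity), Lemma 11 (Vélu), Lemma 12 (Weierstrass
preparation of `t'`: `t' = H⁻¹tᵖφ_ψ(x)u`, `u ≡ 1 (mod p)`) — and an ANALYTIC part: Prop. 13(a)
(`ζ_{𝓔'}(t') = Hζ(t) + (H/p)Dφ_ψ/φ_ψ`, by Lemma 4 and parity), Prop. 13(b)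
(`g - p⁻¹α(g)(t') = log(u)/p`), and the conclusion by Cor. 6(c) (Hazewinkel / Dwork). This file
proves the analytic part once and for all, for abstract isogeny data, and assembles Thm. 1:

* `WeierstrassCurve.zetaTilde W Λ = ζ̃ = (Λ - η)/z` (Blakestad–Grant's `ζ̃ = ζ - Dt/t`, a power
  series), `WeierstrassCurve.formalXReg W = ρ = x + D(Dz/z)` (the regular part of `x`: a power
  series, `z²ρ = X + zηη' - η²`), both over any ring, commuting with base change;
  `formalInvariantDerivation_zetaTilde`: **`Dζ̃ = β - ρ`** for a zeta series (`Dζ = β - x`);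
  `formalInvariantDerivation_subst_of_formalInvDiff_subst`: the chain rule `D(h∘T') = π(D'h)∘T'`
  when `ω'(T')dT' = πω`;
* `eq_zero_of_formalInvariantDerivation_eq_C` — Lemma 4 for power series;
* **`zetaTilde_isogeny_rel_of_formalXReg_rel` — Prop. 13(a), analytic form**, over any
  `p`-adically separated torsion-free ring with unit Hasse coefficients: from the Vélu-level
  identity `(π²ρ'(T') - pρ + T₀)u² = uD²u - (Du)²` (their (7)/(8) with Lemma 12 substituted,
  poles removed) to `(pζ̃ - πζ̃'(T'))u = Du` (their 13(a) times `π = p/H`, poles removed);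
* **`exp_subst_sigmaExpArg_isogeny_eq` — Prop. 13(b), exponentiated**: then
  `exp(p g - g'(T')) = u`, i.e. `σ'(T')/T' = (σ/z)ᵖ/u` (the sigma functions under the isogeny);
* **`coeff_exp_sigmaExpArg_mem_of_isogeny` — Thm. 1 from 13(a)** when `𝓔' = α_*𝓔`,
  `T' ≡ zᵖ`, `u ≡ 1 (mod p)`: `exp(g) ∈ A⟦z⟧`, by the tree's Dwork lemma
  `Literature.RingTheory.FormalGroups.coeff_mem_of_map_subst_eq_pow_mul` applied to
  `(α_*e^g)(T') = (e^g)ᵖ·u⁻¹`;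
* **`UniversalOrdinary.mazur_tate_sigma_existsUnique_of_frobeniusIsogeny`** — the named fact
  from: `A'₄, A'₆ ∈ R̂` with `A'ᵢ ≡ Aᵢᵖ` (`α = frobeniusLift`), `T' ∈ zR̂⟦z⟧` with `T' ≡ zᵖ` and
  `ω'(T')dT' = πω` for `𝓔' = α_*𝓔`, `u ∈ 1 + z²R̂⟦z⟧` with `u ≡ 1`, `T₀ ∈ R̂`, and the
  Vélu-level identity — i.e. exactly the output of Blakestad–Grant's Prop. 7 + Lemmas 10–12
  (tree: Thm. 2 `exists_even_zetaSeries_universalCurve`, Cor. 6(c), Thm. 15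
  `mazur_tate_sigma_existsUnique_of_universal_exp_sigmaExpArg_integral'`); per prime:
  `coeff_exp_sigmaExpArg_universalCurve_mem`; and the variant
  **`mazur_tate_sigma_existsUnique_of_frobeniusIsogeny'`** in which the two identities are only
  required after base change to `K = R̂[1/p]` with `π, T₀ ∈ K` (they descend automatically);
* `WeierstrassCurve.formalXReg_rel_of_velu` — the Vélu-level identity in `ρ`-form FROM Vélu's
  formula summed with Lemma 10, `π²x'(T') = p·x - D² log(t^{1-p}N) - T₀` (pole-free: `hV`), given
  `T' = π·t·N·u` (Lemma 12) and `ω'(T')dT' = πω` — and the corresponding assembly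
  **`UniversalOrdinary.mazur_tate_sigma_existsUnique_of_velu`**.

So, after this file, the remaining input of `mazur_tate_sigma_existsUnique` on Blakestad–Grant's
route is purely the geometry of the canonical `p`-isogeny `ψ : 𝓔 → 𝓔/𝒢` over `R̂`: its target is
`α_*𝓔` (Prop. 7(a),(b)), its parameter `T' = ψ^*t'` is integral and `≡ tᵖ` (Prop. 7(c)),
`ψ^*ω' = πω`, and `ψ^*x' = p·x - Σ'_{Q∈𝒢} x(Q) - D² log Π_{±Q}(x - x(Q))` (Vélu + Lemma 10) with
`T' = π·t·Π_{±Q}(t²x - t²x(Q))·u`, `u ≡ 1 (mod p)` (Lemma 12).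

## The computation (Blakestad–Grant, proof of Prop. 13, in pole-free form)

Write `D = η·d/dz` (`η = 1/W`, `W = ω/dz`), `ζ̃ = (Λ - η)/z`, `ρ = x + D(Dz/z)`; the zeta equation
`zΛ' - Λ = -(X - βz²)W` is `Dζ̃ = β - ρ`. For `T'` with `W'(T')T'^• = πW` one has
`D(h∘T') = π·(D'h)∘T'`. Put `Q = pζ̃ - πζ̃'(T')`; then `DQ = c₁ + (π²ρ'(T') - pρ)` with
`c₁ = pβ - π²β'`, so the hypothesis gives `u²DQ = c u² + (uD²u - (Du)²)`, `c = c₁ - T₀`. Hence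
`R = Qu - Du` satisfies `u·DR - Du·R = c u²`, i.e. `F = R/u` has `DF = c`; `F ∈ R̂⟦z⟧`, so `c = 0`
by Lemma 4 (coefficient of `z^{pⁿ-1}` in `F' = cW`: `pⁿF_{pⁿ} = c·w_{pⁿ-1}`, `w_{pⁿ-1} ∈ R̂ˣ`),
`F` is constant, and `F(0) = Q(0) - u₁ = pζ̃(0) - πζ̃'(0) - u₁ = 0`: `Qu = Du` (13(a)). Then for
`Ψ = p g - g'(T')` (`g' = Wζ̃`): `Ψ'u = W Q u = Wη u' = u'`, so `exp Ψ = u` (13(b)), and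
`(α_*e^g)(T') = e^{α(g)(T')} = e^{pg - Ψ} = (e^g)ᵖ e^{-Ψ} = (e^g)ᵖ u⁻¹` with `u⁻¹ ∈ 1 + pzR̂⟦z⟧`:
Dwork's lemma gives `e^g ∈ R̂⟦z⟧` (Thm. 1).

## Sources

* C. Blakestad, D. Grant, *On the universal `p`-adic sigma and Weierstrass zeta functions*,
  J. Number Theory 249 (2023) 348–376 (arXiv:1903.02480): §2.2, Lemma 4, Cor. 6(c), Prop. 7,
  Def. 8, Cor. 9, Lemmas 10–12, Prop. 13 (eq. (7)–(9)) and the proof of Thm. 1.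
  [BlakestadGrant2023]
* B. Mazur, W. Stein, J. Tate, *Computation of `p`-adic heights and log convergence*, Doc. Math.
  Extra Vol. Coates (2006), Thm. 1.3. [MazurSteinTate2006]
* J. Vélu, *Isogénies entre courbes elliptiques*, C. R. Acad. Sci. Paris 273 (1971) 238–241
  (the shape `x₁ = x + Σ'(x∘τ_Q - x(Q))` behind the hypothesis). [folklore]

## Design notes

Pure proof file: two definitions with bodies (`zetaTilde`, `formalXRegNum`/`formalXReg`), no named
facts, no `sorry`. Prop. 13(a) is proved over an arbitrary commutative ring (`p`-adically separated,
additively torsion-free, `w_{pⁿ-1}` units) for TWO curves `W, W'` and two zeta series — the form in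
which it is a statement about an isogeny; the Frobenius twist `W' = α_*W`, `Λ' = α_*Λ` enters only
in the Dwork step. Parity is replaced by the two scalar conditions it implies (`ζ̃(0) = 0`, i.e.
`[z¹]Λ + a₁ = 0`, and `[z¹]u = 0`).
-/

noncomputable section

open PowerSeries Literature.NumberTheory.EllipticCurves Literature.RingTheory.FormalGroups

namespace WeierstrassCurve

/-! ### `ζ̃ = (Λ - η)/z` and the regular part `ρ = x + D(Dz/z)` of `x`, over any ring -/

section AnyRing

variable {R : Type*} [CommRing R] (W : WeierstrassCurve R)

/-- **Blakestad–Grant's `ζ̃ = ζ - Dt/t` as a power series.** For a zeta series `Λ = zζ`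
(`Λ(0) = 1`), `ζ̃ = Λ/z - η/z = (Λ - η)/z` where `η = Dz = dz/ω` (`formalEta`); the division is
exact. [Blakestad–Grant 2023, §2.2 (`ζ̃_{𝓔/R̂}(t) = ζ_{𝓔/R̂}(t) - Dt/t`)] [cite: BlakestadGrant2023, §2.2] -/
def zetaTilde (Λ : R⟦X⟧) : R⟦X⟧ :=
  PowerSeries.mk fun n => coeff (n + 1) (Λ - W.formalEta)

/-- `z · ζ̃ = Λ - η` when `Λ(0) = 1`. [cite: BlakestadGrant2023, §2.2] -/
theorem X_mul_zetaTilde {Λ : R⟦X⟧} (h0 : constantCoeff Λ = 1) :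
    X * W.zetaTilde Λ = Λ - W.formalEta := by
  have h : constantCoeff (Λ - W.formalEta) = 0 := by
    rw [map_sub, h0, W.constantCoeff_formalEta, sub_self]
  conv_rhs => rw [eq_X_mul_shift_add_const (Λ - W.formalEta), h, map_zero, add_zero]
  rfl

/-- `ζ̃(0) = [z¹]Λ - [z¹]η` (`= [z¹]Λ + a₁`). [folklore] -/
theorem constantCoeff_zetaTilde (Λ : R⟦X⟧) :
    constantCoeff (W.zetaTilde Λ) = coeff 1 Λ - coeff 1 W.formalEta := by
  rw [← coeff_zero_eq_constantCoeff_apply, zetaTilde, coeff_mk, zero_add, map_sub]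

/-- `ζ̃` commutes with base change. [folklore] -/
theorem map_zetaTilde {S : Type*} [CommRing S] (φ : R →+* S) (Λ : R⟦X⟧) :
    PowerSeries.map φ (W.zetaTilde Λ) = (W.map φ).zetaTilde (PowerSeries.map φ Λ) := by
  ext n
  rw [coeff_map, zetaTilde, zetaTilde, coeff_mk, coeff_mk, ← coeff_map, map_sub, W.map_formalEta φ]

/-- `[z¹]η = -a₁` (`ω = (1 + a₁z + ⋯)dz`). [Silverman AEC IV.1] [folklore] -/
theorem coeff_one_formalEta : coeff 1 W.formalEta = -W.a₁ := by
  have hw0 : constantCoeff W.formalW = 0 := by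
    rw [← coeff_zero_eq_constantCoeff_apply]; exact W.coeff_formalW_of_lt_three (by norm_num)
  have hw1 : coeff 1 W.formalW = 0 := W.coeff_formalW_of_lt_three (by norm_num)
  have hw2 : coeff 1 (W.formalW ^ 2) = 0 := by
    rw [pow_two, coeff_mul, Finset.Nat.sum_antidiagonal_eq_sum_range_succ_mk, Finset.sum_range_succ,
      Finset.sum_range_one, coeff_zero_eq_constantCoeff_apply, hw0, zero_mul, zero_add, hw1, zero_mul]
  rw [formalEta_def, map_sub, coeff_one, map_add, map_add, map_add, map_add]
  simp only [coeff_C_mul, coeff_one_X, mul_one, coeff_X_pow, if_neg (show (1 : ℕ) ≠ 2 by norm_num),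
    mul_zero, add_zero]
  rw [show (2 : R⟦X⟧) * C W.a₃ * W.formalW = C (2 * W.a₃) * W.formalW by rw [map_mul, map_ofNat],
    show (2 : R⟦X⟧) * C W.a₄ * X * W.formalW = X * (C (2 * W.a₄) * W.formalW) by
      rw [map_mul, map_ofNat]; ring,
    show (3 : R⟦X⟧) * C W.a₆ * W.formalW ^ 2 = C (3 * W.a₆) * W.formalW ^ 2 by rw [map_mul, map_ofNat],
    coeff_C_mul, hw1, mul_zero, add_zero, coeff_succ_X_mul, coeff_zero_eq_constantCoeff_apply, map_mul,
    hw0, mul_zero, add_zero, coeff_C_mul, hw2, mul_zero, add_zero]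
  simp

/-- **The numerator `z²ρ = X + zηη' - η²` of the regular part of `x`** (`X = z²x`,
`η = Dz`): `x + D(Dz/z) = x + η(η/z)' = (X + zηη' - η²)/z²`. [Blakestad–Grant 2023, proof of
Prop. 13 (the polar parts `Dt/t`, `D't'/t'`)] [folklore] -/
def formalXRegNum : R⟦X⟧ :=
  W.formalXMulSq + X * W.formalEta * d⁄dX R W.formalEta - W.formalEta ^ 2

/-- `z²ρ` has no constant term. [folklore] -/
theorem constantCoeff_formalXRegNum : constantCoeff W.formalXRegNum = 0 := by
  rw [formalXRegNum, map_sub, map_add, map_mul, map_mul, constantCoeff_X, zero_mul, zero_mul,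
    add_zero, map_pow, W.constantCoeff_formalEta, W.constantCoeff_formalXMulSq, one_pow, sub_self]

/-- `z²ρ` has no linear term. [folklore] -/
theorem coeff_one_formalXRegNum : coeff 1 W.formalXRegNum = 0 := by
  have h2 : coeff 1 (W.formalEta ^ 2) = 2 * coeff 1 W.formalEta := by
    rw [pow_two, coeff_mul, Finset.Nat.sum_antidiagonal_eq_sum_range_succ_mk, Finset.sum_range_succ,
      Finset.sum_range_one, coeff_zero_eq_constantCoeff_apply, W.constantCoeff_formalEta]
    simp only [Nat.sub_zero]
    ring
  rw [formalXRegNum, map_sub, map_add, W.coeff_one_formalXMulSq, mul_assoc, coeff_succ_X_mul,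
    coeff_zero_eq_constantCoeff_apply, map_mul, W.constantCoeff_formalEta, one_mul,
    ← coeff_zero_eq_constantCoeff_apply, coeff_derivative, zero_add, Nat.cast_zero, zero_add, mul_one,
    h2, W.coeff_one_formalEta]
  ring

/-- **The regular part `ρ = x + D(Dz/z) ∈ R⟦z⟧` of `x`** (a power series: the double pole of
`x` is cancelled by `D(Dz/z) = -1/z² + ⋯`), defined by `z²ρ = X + zηη' - η²`. For a zeta series,
`Dζ̃ = β - ρ` (`formalInvariantDerivation_zetaTilde`). [Blakestad–Grant 2023, proof of Prop. 13]
[folklore] -/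
def formalXReg : R⟦X⟧ :=
  PowerSeries.mk fun n => coeff (n + 2) W.formalXRegNum

/-- `z² · ρ = X + zηη' - η²`. [folklore] -/
theorem X_sq_mul_formalXReg : X ^ 2 * W.formalXReg = W.formalXRegNum := by
  ext n
  rw [coeff_X_pow_mul']
  split_ifs with h
  · rw [formalXReg, coeff_mk, Nat.sub_add_cancel h]
  · push Not at h
    interval_cases n
    · rw [coeff_zero_eq_constantCoeff, constantCoeff_formalXRegNum]
    · rw [coeff_one_formalXRegNum]

/-- `z²ρ` commutes with base change. [folklore] -/
theorem map_formalXRegNum {S : Type*} [CommRing S] (φ : R →+* S) :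
    PowerSeries.map φ W.formalXRegNum = (W.map φ).formalXRegNum := by
  rw [formalXRegNum, formalXRegNum, map_sub, map_add, map_mul, map_mul, map_X, map_pow,
    W.map_formalEta φ, W.map_formalXMulSq φ, ← derivative_map, W.map_formalEta φ]

/-- `ρ` commutes with base change. [folklore] -/
theorem map_formalXReg {S : Type*} [CommRing S] (φ : R →+* S) :
    PowerSeries.map φ W.formalXReg = (W.map φ).formalXReg := by
  ext n
  rw [coeff_map, formalXReg, formalXReg, coeff_mk, coeff_mk, ← coeff_map, W.map_formalXRegNum φ]

/-- Cancelling `z`: `z·f = z·g → f = g`. [folklore] -/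
theorem _root_.Literature.NumberTheory.EllipticCurves.eq_of_X_mul_eq {f g : R⟦X⟧} (h : X * f = X * g) :
    f = g := by
  ext n
  have := congrArg (coeff (n + 1)) h
  rwa [coeff_succ_X_mul, coeff_succ_X_mul] at this

/-- Cancelling `z²`. [folklore] -/
theorem _root_.Literature.NumberTheory.EllipticCurves.eq_of_X_sq_mul_eq {f g : R⟦X⟧}
    (h : X ^ 2 * f = X ^ 2 * g) : f = g := by
  refine eq_of_X_mul_eq (eq_of_X_mul_eq ?_)
  simpa only [pow_two, mul_assoc] using h

/-- **`Dζ̃ = β - ρ`** for a zeta series `Λ` with constant `β` (`zΛ' - Λ = -(X - βz²)W`, i.e.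
`Dζ = β - x` for `ζ = Λ/z`): subtracting `D(Dz/z)` removes the pole.
[Blakestad–Grant 2023, Thm. 2 and proof of Prop. 13] [cite: BlakestadGrant2023, Prop. 13] -/
theorem formalInvariantDerivation_zetaTilde {Λ : R⟦X⟧} {β : R} (h0 : constantCoeff Λ = 1)
    (hΛ : X * d⁄dX R Λ - Λ = -((W.formalXMulSq - C β * X ^ 2) * W.formalInvDiff)) :
    W.formalInvariantDerivation (W.zetaTilde Λ) = C β - W.formalXReg := by
  have hX := W.X_mul_zetaTilde h0
  have hd : W.zetaTilde Λ + X * d⁄dX R (W.zetaTilde Λ) = d⁄dX R Λ - d⁄dX R W.formalEta := by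
    have := congrArg (d⁄dX R) hX
    rwa [Derivation.leibniz, derivative_X, smul_eq_mul, smul_eq_mul, mul_one, map_sub, add_comm] at this
  have hηW := W.formalEta_mul_formalInvDiff
  have hρ := W.X_sq_mul_formalXReg
  rw [formalXRegNum] at hρ
  refine eq_of_X_sq_mul_eq ?_
  rw [formalInvariantDerivation_apply]
  linear_combination (X * W.formalEta) * hd - W.formalEta * hX + W.formalEta * hΛ
    - (W.formalXMulSq - C β * X ^ 2) * hηW + hρ

/-- `1(T) = 1` for substitution. [folklore] -/
theorem _root_.Literature.NumberTheory.EllipticCurves.one_subst {T : R⟦X⟧} (hT : HasSubst T) :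
    (1 : R⟦X⟧).subst T = 1 := by
  rw [← coe_substAlgHom hT, map_one]

/-- **From `ω'(T')·dT' = π·ω` to `η·T'^• = π·η'(T')`.** [Silverman AEC IV.4 (invariant
differentials under homomorphisms)] [folklore] -/
theorem formalEta_mul_derivative_of_formalInvDiff_subst {W' : WeierstrassCurve R} {T : R⟦X⟧} {π : R}
    (hT0 : constantCoeff T = 0)
    (hTω : W'.formalInvDiff.subst T * d⁄dX R T = C π * W.formalInvDiff) :
    W.formalEta * d⁄dX R T = C π * W'.formalEta.subst T := by
  have hs : HasSubst T := HasSubst.of_constantCoeff_zero' hT0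
  have h1 : W'.formalInvDiff.subst T * W'.formalEta.subst T = 1 := by
    rw [← subst_mul hs, W'.formalInvDiff_mul_formalEta, one_subst hs]
  have hηW := W.formalEta_mul_formalInvDiff
  linear_combination (W.formalEta * W'.formalEta.subst T) * hTω
    - (W.formalEta * d⁄dX R T) * h1 + (C π * W'.formalEta.subst T) * hηW

/-- **Chain rule for the invariant derivations along a homomorphism of formal groups**: if
`ω'(T'(z))·T'^•(z) = π·ω(z)` (the isogeny `T'` pulls `ω'` back to `πω`), then
`D(h ∘ T') = π · (D'h) ∘ T'`. [Blakestad–Grant 2023, §2.2 ("for any `g ∈ K(E')`,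
`D'(g) = (H/p)D(g)`")] [cite: BlakestadGrant2023, §2.2] -/
theorem formalInvariantDerivation_subst_of_formalInvDiff_subst {W' : WeierstrassCurve R} {T : R⟦X⟧} {π : R}
    (hT0 : constantCoeff T = 0)
    (hTω : W'.formalInvDiff.subst T * d⁄dX R T = C π * W.formalInvDiff) (h : R⟦X⟧) :
    W.formalInvariantDerivation (h.subst T) = C π * (W'.formalInvariantDerivation h).subst T := by
  have hs : HasSubst T := HasSubst.of_constantCoeff_zero' hT0
  have key := W.formalEta_mul_derivative_of_formalInvDiff_subst hT0 hTω
  rw [formalInvariantDerivation_apply, derivative_subst R hs, formalInvariantDerivation_apply,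
    subst_mul hs]
  linear_combination ((d⁄dX R h).subst T) * key

end AnyRing

end WeierstrassCurve

namespace WeierstrassCurve

/-! ### Blakestad–Grant's Prop. 13(a) from the Vélu-level identity (Lemma 4 + parity) -/

section PropThirteen

variable {R : Type*} [CommRing R] (W : WeierstrassCurve R)

/-- A series with zero derivative is constant (torsion-free coefficients). [folklore] -/
theorem _root_.Literature.NumberTheory.EllipticCurves.eq_C_of_derivative_eq_zero [IsAddTorsionFree R]
    {F : R⟦X⟧} (h : d⁄dX R F = 0) : F = C (constantCoeff F) := by
  ext n
  rcases n with _ | n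
  · simp
  · rw [coeff_C, if_neg (Nat.succ_ne_zero n)]
    have h1 := congrArg (coeff n) h
    rw [coeff_derivative, map_zero] at h1
    rw [← nsmul_eq_zero_iff_right (Nat.succ_ne_zero n), nsmul_eq_mul, Nat.cast_succ, mul_comm]
    exact h1

/-- `D(C r · f) = C r · D f`. [folklore] -/
theorem formalInvariantDerivation_C_mul (r : R) (f : R⟦X⟧) :
    W.formalInvariantDerivation (C r * f) = C r * W.formalInvariantDerivation f := by
  rw [Derivation.leibniz, formalInvariantDerivation_C, smul_zero, add_zero, smul_eq_mul]

/-- **Blakestad–Grant's Lemma 4, power-series case**: over a `p`-adically separated ring in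
which the Hasse coefficients `w_{pⁿ-1}` of `ω` are units, `D F = c` (constant) for a power
series `F` forces `c = 0` — compare the coefficients of `z^{pⁿ-1}` in `F' = c·ω/dz`.
[Blakestad–Grant 2023, Lemma 4] [cite: BlakestadGrant2023, Lemma 4] -/
theorem eq_zero_of_formalInvariantDerivation_eq_C (p : ℕ) [Fact p.Prime]
    (hsep : ∀ c : R, (∀ n : ℕ, c ∈ Ideal.span {(p : R) ^ (n + 1)}) → c = 0)
    (hw : ∀ n : ℕ, IsUnit (coeff (p ^ (n + 1) - 1) W.formalInvDiff))
    {F : R⟦X⟧} {c : R} (h : W.formalInvariantDerivation F = C c) : c = 0 := by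
  have hp : p.Prime := Fact.out
  refine hsep c fun n => ?_
  have hηW := W.formalEta_mul_formalInvDiff
  have h1 : d⁄dX R F = C c * W.formalInvDiff := by
    rw [formalInvariantDerivation_apply] at h
    linear_combination W.formalInvDiff * h - (d⁄dX R F) * hηW
  have hN : p ^ (n + 1) - 1 + 1 = p ^ (n + 1) := Nat.sub_add_cancel (Nat.one_le_pow _ _ hp.pos)
  have h2 := congrArg (coeff (p ^ (n + 1) - 1)) h1
  rw [coeff_derivative, coeff_C_mul, hN] at h2
  have hcast : ((p ^ (n + 1) - 1 : ℕ) : R) + 1 = (p : R) ^ (n + 1) := by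
    have h := congrArg (Nat.cast (R := R)) hN
    push_cast at h
    exact h
  rw [hcast] at h2
  obtain ⟨w, hw'⟩ := (hw n).exists_right_inv
  refine Ideal.mem_span_singleton'.mpr ⟨coeff (p ^ (n + 1)) F * w, ?_⟩
  calc coeff (p ^ (n + 1)) F * w * (p : R) ^ (n + 1)
      = (coeff (p ^ (n + 1)) F * (p : R) ^ (n + 1)) * w := by ring
    _ = c * (coeff (p ^ (n + 1) - 1) W.formalInvDiff * w) := by rw [h2]; ring
    _ = c := by rw [hw', mul_one]

/-- **Blakestad–Grant's Prop. 13(a), analytic form.** Data: two Weierstrass curves `W, W'` over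
a `p`-adically separated torsion-free ring `R` with the Hasse coefficients of `W` units; zeta
series `Λ, Λ'` (constants `β, β'`; `ζ̃ = (Λ - η)/z`, `ζ̃' = (Λ' - η')/z` with `ζ̃(0) = ζ̃'(0) = 0`);
a series `T' ∈ zR⟦z⟧` with `ω'(T')dT' = πω` (the `p`-isogeny on formal groups); a unit series
`u = 1 + O(z²)`. HYPOTHESIS (the Vélu-level identity, Blakestad–Grant's (7)/(8): "`x₁ = px -
T'(x) - D(Dφ_ψ/φ_ψ)`" with `x₁ = π²x'(t')` and Lemma 12's `t' = H⁻¹tᵖφ_ψ(x)u`, all poles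
removed): `(π²·ρ'(T') - p·ρ + T₀)·u² = u·D²u - (Du)²` where `ρ = x + D(Dz/z)` (`formalXReg`).
CONCLUSION (their Prop. 13(a) `ζ_{𝓔'}(t') = Hζ(t) + (H/p)Dφ_ψ/φ_ψ`, multiplied by `π = p/H` and
with `Dt/t`, `D't'/t'` removed): `(p·ζ̃ - π·ζ̃'(T'))·u = Du`. Proof (theirs): `D` of the
difference is a constant `η`; the difference divided by `u` is an integral series `F` with
`DF = η`, so `η = 0` by Lemma 4, `F` is constant, and `F(0) = 0`.
[Blakestad–Grant 2023, Prop. 13(a) and its proof, eq. (7)–(9)] [cite: BlakestadGrant2023, Prop. 13] -/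
theorem zetaTilde_isogeny_rel_of_formalXReg_rel (p : ℕ) [Fact p.Prime] [IsAddTorsionFree R]
    (hsep : ∀ c : R, (∀ n : ℕ, c ∈ Ideal.span {(p : R) ^ (n + 1)}) → c = 0)
    (hw : ∀ n : ℕ, IsUnit (coeff (p ^ (n + 1) - 1) W.formalInvDiff))
    {W' : WeierstrassCurve R} {Λ Λ' T u : R⟦X⟧} {β β' π T₀ : R}
    (hΛ0 : constantCoeff Λ = 1)
    (hΛ : X * d⁄dX R Λ - Λ = -((W.formalXMulSq - C β * X ^ 2) * W.formalInvDiff))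
    (hΛ'0 : constantCoeff Λ' = 1)
    (hΛ' : X * d⁄dX R Λ' - Λ' = -((W'.formalXMulSq - C β' * X ^ 2) * W'.formalInvDiff))
    (hT0 : constantCoeff T = 0)
    (hTω : W'.formalInvDiff.subst T * d⁄dX R T = C π * W.formalInvDiff)
    (hu0 : constantCoeff u = 1) (hu1 : coeff 1 u = 0)
    (hζ0 : constantCoeff (W.zetaTilde Λ) = 0) (hζ'0 : constantCoeff (W'.zetaTilde Λ') = 0)
    (hB : (C (π ^ 2) * (W'.formalXReg).subst T - (p : R⟦X⟧) * W.formalXReg + C T₀) * u ^ 2 =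
      logDeriv₂Num W.formalInvariantDerivation u) :
    ((p : R⟦X⟧) * W.zetaTilde Λ - C π * (W'.zetaTilde Λ').subst T) * u =
      W.formalInvariantDerivation u := by
  have hs : HasSubst T := HasSubst.of_constantCoeff_zero' hT0
  -- (1)–(2): `Dζ̃ = β - ρ`, `D(ζ̃'∘T') = π(β' - ρ'∘T')`
  have h1 : W.formalInvariantDerivation (W.zetaTilde Λ) = C β - W.formalXReg :=
    W.formalInvariantDerivation_zetaTilde hΛ0 hΛ
  have h2 : W.formalInvariantDerivation ((W'.zetaTilde Λ').subst T) =
      C π * (C β' - (W'.formalXReg).subst T) := by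
    rw [W.formalInvariantDerivation_subst_of_formalInvDiff_subst hT0 hTω,
      W'.formalInvariantDerivation_zetaTilde hΛ'0 hΛ', subst_sub hs, subst_C]
    rfl
  -- (3): `Q = pζ̃ - πζ̃'(T')` and `DQ`
  set Q := (p : R⟦X⟧) * W.zetaTilde Λ - C π * (W'.zetaTilde Λ').subst T with hQ
  have hDQ : W.formalInvariantDerivation Q =
      C (p : R) * (C β - W.formalXReg) - C π * (C π * (C β' - (W'.formalXReg).subst T)) := by
    rw [hQ, map_sub, ← map_natCast (C (R := R)) p, W.formalInvariantDerivation_C_mul, h1,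
      W.formalInvariantDerivation_C_mul, h2]
  -- (4): `R = Qu - Du` has `u·DR - Du·R = c·u²`
  set Rr := Q * u - W.formalInvariantDerivation u with hRr
  set c' : R⟦X⟧ := C (p : R) * C β - C π * C π * C β' - C T₀ with hc'
  have h4 : u * W.formalInvariantDerivation Rr - W.formalInvariantDerivation u * Rr = c' * u ^ 2 := by
    have hL := hB
    rw [logDeriv₂Num_def, map_pow] at hL
    rw [hRr, map_sub, Derivation.leibniz, smul_eq_mul, smul_eq_mul, hDQ, hc']
    rw [← map_natCast (C (R := R)) p] at hL
    linear_combination hL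
  -- (5): `F = R/u` has `DF = c`
  set v := u.invOfUnit 1 with hv
  have huv : u * v = 1 := mul_invOfUnit u 1 (by rw [hu0, Units.val_one])
  have hDv : u * W.formalInvariantDerivation v + v * W.formalInvariantDerivation u = 0 := by
    have h := (W.formalInvariantDerivation).leibniz u v
    rw [huv, Derivation.map_one_eq_zero, smul_eq_mul, smul_eq_mul] at h
    linear_combination -h
  set F := Rr * v with hF
  have hDF : W.formalInvariantDerivation F = c' := by
    rw [hF, Derivation.leibniz, smul_eq_mul, smul_eq_mul]
    linear_combination v ^ 2 * h4 + (Rr * v) * hDv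
      - ((Rr * W.formalInvariantDerivation v + v * W.formalInvariantDerivation Rr) - c' * (1 + u * v)) * huv
  -- (6): Lemma 4 gives `c = 0`
  have hc : (p : R) * β - π * π * β' - T₀ = 0 := by
    refine W.eq_zero_of_formalInvariantDerivation_eq_C p hsep hw (F := F) ?_
    rw [hDF, hc', map_sub, map_sub, map_mul, map_mul, map_mul]
  have hDF0 : W.formalInvariantDerivation F = 0 := by
    rw [hDF, hc', ← map_mul, ← map_mul, ← map_mul, ← map_sub, ← map_sub, hc, map_zero]
  -- (7): `F` is constant, and `F(0) = 0`
  have hF' : d⁄dX R F = 0 := by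
    have hηW := W.formalEta_mul_formalInvDiff
    rw [formalInvariantDerivation_apply] at hDF0
    linear_combination W.formalInvDiff * hDF0 - (d⁄dX R F) * hηW
  have hF0 : constantCoeff F = 0 := by
    have hv0 : constantCoeff v = 1 := by
      have := congrArg constantCoeff huv
      rwa [map_mul, hu0, one_mul, map_one] at this
    have hQ0 : constantCoeff Q = 0 := by
      rw [hQ, map_sub, map_mul, map_mul, map_natCast, hζ0, mul_zero,
        constantCoeff_subst_of_constantCoeff_eq_zero hT0, hζ'0, mul_zero, sub_zero]
    have hDu0 : constantCoeff (W.formalInvariantDerivation u) = 0 := by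
      rw [formalInvariantDerivation_apply, map_mul, ← coeff_zero_eq_constantCoeff_apply (d⁄dX R u),
        coeff_derivative, zero_add, hu1, zero_mul, mul_zero]
    rw [hF, map_mul, hRr, map_sub, map_mul, hQ0, zero_mul, hDu0, sub_zero, zero_mul]
  have hFz : F = 0 := by
    rw [eq_C_of_derivative_eq_zero hF', hF0, map_zero]
  -- (8): `R = F·u = 0`
  have hR0 : Rr = 0 := by
    calc Rr = Rr * (u * v) := by rw [huv, mul_one]
      _ = F * u := by rw [hF]; ring
      _ = 0 := by rw [hFz, zero_mul]
  rw [← sub_eq_zero]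
  exact hR0

end PropThirteen

end WeierstrassCurve

namespace WeierstrassCurve

/-! ### Prop. 13(b): the sigma function under the isogeny, and Thm. 1 by Dwork's lemma -/

section SigmaIsogeny

variable {K : Type*} [CommRing K] [Algebra ℚ K]

/-- **`g' = ω·ζ̃`** for `g = ∫ζ̃ω = sigmaExpArg` (`zg' = ΛW - 1 = W·(Λ - η) = W·zζ̃`).
[Blakestad–Grant 2023, §2.2] [folklore] -/
theorem derivative_sigmaExpArg (W : WeierstrassCurve K) {Λ : K⟦X⟧} (h0 : constantCoeff Λ = 1) :
    d⁄dX K (W.sigmaExpArg Λ) = W.formalInvDiff * W.zetaTilde Λ := by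
  refine eq_of_X_mul_eq ?_
  rw [X_mul_derivative_sigmaExpArg h0, ← W.formalInvDiff_eq_formalOmega]
  have hX := W.X_mul_zetaTilde h0
  have hWη := W.formalInvDiff_mul_formalEta
  linear_combination (-W.formalInvDiff) * hX + hWη

/-- **The sigma functions under the isogeny (Blakestad–Grant's Prop. 13(b), exponentiated).**
Over a `ℚ`-algebra, let `g = ∫ζ̃ω`, `g' = ∫ζ̃'ω'` be the `sigmaExpArg`s of zeta series `Λ, Λ'`
of two curves `W, W'`, `T' ∈ zK⟦z⟧` with `ω'(T')dT' = πω`, and `u = 1 + ⋯`. If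
`(p·ζ̃ - π·ζ̃'(T'))·u = Du` (Prop. 13(a), analytic form), then
**`exp(p·g - g'(T')) = u`** — Blakestad–Grant's "`g(t) - p⁻¹α(g)(t') = log(u(t))/p`", i.e.
`σ'(T')/T' = (σ/z)ᵖ/u` for `σ = z·exp g`, `σ' = z·exp g'` (the transformation of sigma functions
under a `p`-isogeny). Proof: `D` of `p g - g'(T')` is `p ζ̃ - πζ̃'(T') = Du/u`.
[Blakestad–Grant 2023, Prop. 13(b) and its proof] [cite: BlakestadGrant2023, Prop. 13] -/
theorem exp_subst_sigmaExpArg_isogeny_eq {W W' : WeierstrassCurve K} {Λ Λ' T u : K⟦X⟧} {π : K}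
    (p : ℕ) (hΛ0 : constantCoeff Λ = 1) (hΛ'0 : constantCoeff Λ' = 1) (hT0 : constantCoeff T = 0)
    (hTω : W'.formalInvDiff.subst T * d⁄dX K T = C π * W.formalInvDiff) (hu0 : constantCoeff u = 1)
    (hQ : ((p : K⟦X⟧) * W.zetaTilde Λ - C π * (W'.zetaTilde Λ').subst T) * u =
      W.formalInvariantDerivation u) :
    (exp K).subst ((p : K⟦X⟧) * W.sigmaExpArg Λ - (W'.sigmaExpArg Λ').subst T) = u := by
  haveI := IsAddTorsionFree.of_module_rat (M := K)
  have hs : HasSubst T := HasSubst.of_constantCoeff_zero' hT0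
  set Ψ : K⟦X⟧ := (p : K⟦X⟧) * W.sigmaExpArg Λ - (W'.sigmaExpArg Λ').subst T with hΨ
  have hΨ0 : constantCoeff Ψ = 0 := by
    rw [hΨ, map_sub, map_mul, constantCoeff_sigmaExpArg, mul_zero,
      constantCoeff_subst_of_constantCoeff_eq_zero hT0, constantCoeff_sigmaExpArg, sub_zero]
  -- `Ψ'·u = u'`
  have hkey : d⁄dX K Ψ * u = d⁄dX K u := by
    have hg := derivative_sigmaExpArg W hΛ0
    have hg' := derivative_sigmaExpArg W' hΛ'0
    have hWη := W.formalInvDiff_mul_formalEta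
    have hQ' := hQ
    rw [formalInvariantDerivation_apply, ← map_natCast (C (R := K)) p] at hQ'
    rw [hΨ, map_sub, ← map_natCast (C (R := K)) p, Derivation.leibniz, derivative_C, smul_zero,
      add_zero, smul_eq_mul, derivative_subst K hs, hg, hg', subst_mul hs]
    linear_combination (-((W'.zetaTilde Λ').subst T) * u) * hTω + W.formalInvDiff * hQ'
      + (d⁄dX K u) * hWη
  -- `E = exp Ψ` and `u` satisfy the same first-order equation
  set E : K⟦X⟧ := (exp K).subst Ψ with hE
  have hE0 : constantCoeff E = 1 := constantCoeff_exp_subst hΨ0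
  have hE' : d⁄dX K E = E * d⁄dX K Ψ := derivative_exp_subst hΨ0
  have hG : d⁄dX K (E - u) * u = (E - u) * d⁄dX K u := by
    rw [map_sub, hE']
    linear_combination E * hkey
  set v := u.invOfUnit 1 with hv
  have huv : u * v = 1 := mul_invOfUnit u 1 (by rw [hu0, Units.val_one])
  have hdv : u * d⁄dX K v + v * d⁄dX K u = 0 := by
    have h := (d⁄dX K).leibniz u v
    rw [huv, Derivation.map_one_eq_zero, smul_eq_mul, smul_eq_mul] at h
    linear_combination -h
  have hGv : (E - u) * v = 0 := by
    refine derivative.ext ?_ ?_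
    · rw [Derivation.leibniz, smul_eq_mul, smul_eq_mul, map_zero]
      linear_combination v ^ 2 * hG + ((E - u) * v) * hdv
        - ((E - u) * d⁄dX K v + v * d⁄dX K (E - u)) * huv
    · rw [map_mul, map_sub, hE0, hu0, sub_self, zero_mul, map_zero]
  linear_combination u * hGv - (E - u) * huv

/-- Inverting a unit series congruent to `1` modulo an ideal. [folklore] -/
theorem _root_.Literature.NumberTheory.EllipticCurves.coeff_succ_mem_of_mul_eq_one
    {R : Type*} [CommRing R] (I : Ideal R) {u v : R⟦X⟧} (huv : u * v = 1)
    (hu0 : constantCoeff u = 1) (hu : ∀ n, coeff (n + 1) u ∈ I) : ∀ n, coeff (n + 1) v ∈ I := by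
  intro n
  induction n using Nat.strong_induction_on with
  | _ n ih =>
    have h := congrArg (coeff (n + 1)) huv
    rw [coeff_mul, coeff_one, if_neg (Nat.succ_ne_zero n), Finset.Nat.sum_antidiagonal_eq_sum_range_succ
      (fun i j => coeff i u * coeff j v) (n + 1), Finset.sum_range_succ', coeff_zero_eq_constantCoeff_apply,
      hu0, one_mul, Nat.sub_zero] at h
    -- `v_{n+1} = -Σ_{i ≥ 1} u_i v_{n+1-i}`
    have hv : coeff (n + 1) v = -∑ i ∈ Finset.range (n + 1), coeff (i + 1) u * coeff (n + 1 - (i + 1)) v := by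
      linear_combination h
    rw [hv]
    refine I.neg_mem (I.sum_mem fun i hi => I.mul_mem_right _ (hu i))

/-- **Blakestad–Grant's Thm. 1 from their Prop. 13(a) (analytic form), by Dwork's lemma.**
`K` a `ℚ`-algebra, `A ⊆ K` a subring with `K = A[1/p]`, `α` an endomorphism of `K` preserving
`A` with `α ≡ Frob (mod pA)`; `W` a curve over `K`, `Λ = 1 + ⋯` with `ζ̃(0) ∈ A`;
`T' ∈ A⟦z⟧`, `T' ≡ zᵖ (mod p)`, with `(α_*ω)(T')dT' = πω`; `u ∈ 1 + pzA⟦z⟧`. If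
`(p·ζ̃ - π·(α_*ζ̃)(T'))·u = Du`, then **`exp(∫ζ̃ω) ∈ A⟦z⟧`**: by
`exp_subst_sigmaExpArg_isogeny_eq`, `(α_* e^g)(T') = (e^g)ᵖ · u⁻¹` with `u⁻¹ ∈ 1 + pzA⟦z⟧`,
and Dwork's integrality lemma (`coeff_mem_of_map_subst_eq_pow_mul`, the engine of Hazewinkel's
functional equation lemma / Blakestad–Grant's Cor. 6(c)) applies.
[Blakestad–Grant 2023, proof of Thm. 1 (Prop. 13(b) + Cor. 6(c))] [cite: BlakestadGrant2023, Thm. 1] -/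
theorem coeff_exp_sigmaExpArg_mem_of_isogeny (p : ℕ) [Fact p.Prime] (A : Subring K) (α : K →+* K)
    (hK : ∀ x : K, ∃ k : ℕ, (p : K) ^ k * x ∈ A)
    (hαA : ∀ r ∈ A, α r ∈ A) (hα : ∀ r ∈ A, ∃ a ∈ A, α r = r ^ p + p * a)
    (W : WeierstrassCurve K) {Λ T u : K⟦X⟧} {π : K}
    (hΛ0 : constantCoeff Λ = 1) (hζA : constantCoeff (W.zetaTilde Λ) ∈ A)
    (hT0 : constantCoeff T = 0) (hT : ∀ n, ∃ b ∈ A, coeff n T = (if n = p then 1 else 0) + p * b)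
    (hTω : (W.map α).formalInvDiff.subst T * d⁄dX K T = C π * W.formalInvDiff)
    (hu0 : constantCoeff u = 1) (hu : ∀ n, ∃ a ∈ A, coeff (n + 1) u = p * a)
    (hQ : ((p : K⟦X⟧) * W.zetaTilde Λ - C π * ((W.map α).zetaTilde (Λ.map α)).subst T) * u =
      W.formalInvariantDerivation u) :
    ∀ n, coeff n ((exp K).subst (W.sigmaExpArg Λ)) ∈ A := by
  have hpK : IsUnit ((p : ℕ) : K) := isUnit_natCast_prime p
  have hΛ'0 : constantCoeff (Λ.map α) = 1 := by
    rw [← coeff_zero_eq_constantCoeff_apply, coeff_map, coeff_zero_eq_constantCoeff_apply, hΛ0, map_one]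
  have hiso := exp_subst_sigmaExpArg_isogeny_eq p hΛ0 hΛ'0 hT0 hTω hu0 hQ
  rw [← W.map_sigmaExpArg α Λ] at hiso
  set g := W.sigmaExpArg Λ with hg
  have hg0 : constantCoeff g = 0 := constantCoeff_sigmaExpArg Λ
  have hgα0 : constantCoeff (g.map α) = 0 := by
    rw [← coeff_zero_eq_constantCoeff_apply, coeff_map, coeff_zero_eq_constantCoeff_apply, hg0, map_zero]
  set Ψ : K⟦X⟧ := (p : K⟦X⟧) * g - (g.map α).subst T with hΨ
  have hΨ0 : constantCoeff Ψ = 0 := by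
    rw [hΨ, map_sub, map_mul, hg0, mul_zero, constantCoeff_subst_of_constantCoeff_eq_zero hT0, hgα0,
      sub_zero]
  have hnΨ0 : constantCoeff (-Ψ) = 0 := by rw [map_neg, hΨ0, neg_zero]
  have hpg0 : constantCoeff (p • g) = 0 := by rw [map_nsmul, hg0, smul_zero]
  -- `(α_* e^g)(T') = (e^g)ᵖ · e^{-Ψ}`
  set s : K⟦X⟧ := (exp K).subst g with hs
  set v : K⟦X⟧ := (exp K).subst (-Ψ) with hv
  have heq : (s.map α).subst T = s ^ p * v := by
    rw [hs, map_exp_subst α hg0, exp_subst_subst hgα0 hT0,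
      show (g.map α).subst T = p • g + -Ψ by rw [hΨ, nsmul_eq_mul]; ring,
      exp_subst_add hpg0 hnΨ0, exp_subst_nsmul hg0]
  -- `e^{-Ψ} = u⁻¹ ∈ 1 + pzA⟦z⟧`
  have huv : u * v = 1 := by rw [← hiso, hv, exp_subst_mul_exp_subst_neg hΨ0]
  have hv0 : constantCoeff v = 1 := constantCoeff_exp_subst hnΨ0
  have huA : ∀ n, coeff n u ∈ A := fun n => by
    rcases n with _ | n
    · rw [coeff_zero_eq_constantCoeff, hu0]; exact A.one_mem
    · obtain ⟨a, ha, h⟩ := hu n; rw [h]; exact A.mul_mem (natCast_mem A p) ha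
  obtain ⟨u₀, hu₀⟩ := exists_map_subtype_eq_of_coeff_mem A huA
  have hvA : ∀ n, ∃ a ∈ A, coeff (n + 1) v = p * a := by
    -- invert `u₀` inside `A⟦z⟧`
    have hu₀0 : constantCoeff u₀ = 1 := by
      apply Subtype.ext
      have h1 : ((constantCoeff u₀ : A) : K) = constantCoeff u := by
        have := congrArg constantCoeff hu₀
        rwa [← coeff_zero_eq_constantCoeff_apply, coeff_map, coeff_zero_eq_constantCoeff_apply] at this
      rw [OneMemClass.coe_one, h1, hu0]
    set v₀ := u₀.invOfUnit 1 with hv₀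
    have huv₀ : u₀ * v₀ = 1 := mul_invOfUnit u₀ 1 (by rw [hu₀0, Units.val_one])
    have hvmap : v = v₀.map A.subtype := by
      have h1 : u * v₀.map A.subtype = 1 := by rw [← hu₀, ← map_mul, huv₀, map_one]
      calc v = (u * v₀.map A.subtype) * v := by rw [h1, one_mul]
        _ = v₀.map A.subtype * (u * v) := by ring
        _ = v₀.map A.subtype := by rw [huv, mul_one]
    have hI : ∀ n, coeff (n + 1) u₀ ∈ Ideal.span {(p : A)} := fun n => by
      obtain ⟨a, ha, h⟩ := hu n
      refine Ideal.mem_span_singleton'.mpr ⟨⟨a, ha⟩, Subtype.ext ?_⟩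
      have hc : ((coeff (n + 1) u₀ : A) : K) = coeff (n + 1) u := by
        have := congrArg (coeff (n + 1)) hu₀
        rwa [coeff_map] at this
      change ((⟨a, ha⟩ * (p : A) : A) : K) = ((coeff (n + 1) u₀ : A) : K)
      rw [hc, h]; push_cast; ring
    intro n
    obtain ⟨a, ha⟩ := Ideal.mem_span_singleton'.mp (coeff_succ_mem_of_mul_eq_one _ huv₀ hu₀0 hI n)
    refine ⟨a, a.2, ?_⟩
    have hc : coeff (n + 1) v = ((coeff (n + 1) v₀ : A) : K) := by rw [hvmap, coeff_map]; rfl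
    rw [hc, ← ha]; push_cast; ring
  -- Dwork's lemma
  have hs0 : constantCoeff s = 1 := constantCoeff_exp_subst hg0
  have hs1 : coeff 1 s ∈ A := by
    rw [hs, coeff_one_exp_subst hg0, hg]
    have h1 := congrArg (coeff 0) (derivative_sigmaExpArg W hΛ0)
    rw [coeff_derivative, zero_add, Nat.cast_zero, zero_add, mul_one, coeff_mul, Finset.Nat.antidiagonal_zero,
      Finset.sum_singleton, coeff_zero_eq_constantCoeff_apply, W.constantCoeff_formalInvDiff, one_mul,
      coeff_zero_eq_constantCoeff_apply] at h1
    rw [h1]; exact hζA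
  exact coeff_mem_of_map_subst_eq_pow_mul p A α hpK hK hαA hα hT0 hT hs0 hs1 hv0 hvA heq

end SigmaIsogeny

end WeierstrassCurve

/-! ### Assembly over `R̂`: the named fact from the data of a Frobenius `p`-isogeny -/

namespace Literature.NumberTheory.EllipticCurves.UniversalOrdinary

open WeierstrassCurve

/-- From the `(p)`-congruence form to the `p · b` form along `R̂ → K`. [folklore] -/
theorem exists_mem_intSubring_of_sub_mem_span (p : ℕ) {x δ : completeRing p}
    (h : x - δ ∈ Ideal.span {(p : completeRing p)}) :
    ∃ b ∈ intSubring p, algebraMap (completeRing p) (completeRingQ p) x =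
      algebraMap (completeRing p) (completeRingQ p) δ + p * b := by
  obtain ⟨b, hb⟩ := Ideal.mem_span_singleton'.mp h
  refine ⟨algebraMap _ _ b, ⟨b, rfl⟩, ?_⟩
  rw [← map_natCast (algebraMap (completeRing p) (completeRingQ p)) p, ← map_mul, ← map_add,
    mul_comm, hb, add_sub_cancel]

/-- **Thm. 1 over `R̂` for one prime, from `R̂`-valued isogeny data** (the per-prime content of
`mazur_tate_sigma_existsUnique_of_frobeniusIsogeny` below): for `p ≥ 5`, data
`A'₄, A'₆, T', u, π, T₀` as there, and ANY even zeta series `Λ` of `𝓔 = universalCurve p`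
(constant `β`), `exp(∫ζ̃ω)` has coefficients in `R̂ ⊆ K = R̂[1/p]`.
[Blakestad–Grant 2023, Thm. 1 (proof: Prop. 13 + Cor. 6(c))] [cite: BlakestadGrant2023, Thm. 1] -/
theorem coeff_exp_sigmaExpArg_universalCurve_mem (p : ℕ) [Fact p.Prime] (hp5 : 5 ≤ p)
    {A'₄ A'₆ : completeRing p} (h₄ : A'₄ - univA₄ p ^ p ∈ Ideal.span {(p : completeRing p)})
    (h₆ : A'₆ - univA₆ p ^ p ∈ Ideal.span {(p : completeRing p)})
    {T u : PowerSeries (completeRing p)} {π T₀ : completeRing p}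
    (hT0 : constantCoeff T = 0)
    (hT : ∀ n, coeff n T - (if n = p then 1 else 0) ∈ Ideal.span {(p : completeRing p)})
    (hu0 : constantCoeff u = 1) (hu1 : coeff 1 u = 0)
    (hu : ∀ n, coeff (n + 1) u ∈ Ideal.span {(p : completeRing p)})
    (hTω : ((universalCurve p).map (frobeniusLift p A'₄ A'₆ h₄ h₆)).formalInvDiff.subst T *
        d⁄dX (completeRing p) T = C π * (universalCurve p).formalInvDiff)
    (hB : (C (π ^ 2) * (((universalCurve p).map (frobeniusLift p A'₄ A'₆ h₄ h₆)).formalXReg).subst T -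
        (p : PowerSeries (completeRing p)) * (universalCurve p).formalXReg + C T₀) * u ^ 2 =
      logDeriv₂Num (universalCurve p).formalInvariantDerivation u)
    {β : completeRing p} {Λ : PowerSeries (completeRing p)} (h0 : constantCoeff Λ = 1)
    (hev : rescale (-1 : completeRing p) Λ = Λ)
    (hΛ : X * d⁄dX (completeRing p) Λ - Λ =
      -(((universalCurve p).formalXMulSq - C β * X ^ 2) * (universalCurve p).formalInvDiff)) (n : ℕ) :
    coeff n ((exp (completeRingQ p)).subst
      (((universalCurve p).map (algebraMap (completeRing p) (completeRingQ p))).sigmaExpArg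
        (PowerSeries.map (algebraMap (completeRing p) (completeRingQ p)) Λ))) ∈ intSubring p := by
  haveI := isAddTorsionFree_completeRing p hp5
  set α := frobeniusLift p A'₄ A'₆ h₄ h₆ with hαdef
  set E := universalCurve p with hE
  -- Prop. 13(a) over `R̂`
  have hsep : ∀ c : completeRing p, (∀ n : ℕ, c ∈ Ideal.span {(p : completeRing p) ^ (n + 1)}) → c = 0 := by
    intro c hc
    refine IsHausdorff.haus' (I := Ideal.span {(p : completeRing p)}) c fun n => ?_
    rw [Ideal.span_singleton_pow, smodEq_smul_top_iff_sub_mem, sub_zero]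
    rcases n with _ | n
    · rw [pow_zero, Ideal.span_singleton_one]; exact Submodule.mem_top
    · exact hc n
  have hw := isUnit_coeff_formalInvDiff_universalCurve_pow p hp5
  have hΛ' := E.map_zetaSeries_eq α hΛ
  have hΛ'0 : constantCoeff (PowerSeries.map α Λ) = 1 := by
    rw [← coeff_zero_eq_constantCoeff_apply, coeff_map, coeff_zero_eq_constantCoeff_apply, h0, map_one]
  have hΛ1 : coeff 1 Λ = 0 := coeff_eq_zero_of_rescale_neg_one_eq_self hev odd_one
  have hζ0 : constantCoeff (E.zetaTilde Λ) = 0 := by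
    rw [WeierstrassCurve.constantCoeff_zetaTilde, WeierstrassCurve.coeff_one_formalEta, hΛ1, hE]
    change (0 : completeRing p) - -0 = 0
    rw [neg_zero, sub_zero]
  have hζ'0 : constantCoeff ((E.map α).zetaTilde (PowerSeries.map α Λ)) = 0 := by
    rw [WeierstrassCurve.constantCoeff_zetaTilde, WeierstrassCurve.coeff_one_formalEta, coeff_map, hΛ1, map_zero, WeierstrassCurve.map_a₁, hE]
    change (0 : completeRing p) - -(α 0) = 0
    rw [map_zero, neg_zero, sub_zero]
  have hQ := E.zetaTilde_isogeny_rel_of_formalXReg_rel p hsep hw h0 hΛ hΛ'0 hΛ' hT0 hTω hu0 hu1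
    hζ0 hζ'0 hB
  -- base change to `K = R̂[1/p]`
  set ι := algebraMap (completeRing p) (completeRingQ p) with hι
  set αK := extendQ p α with hαK
  have hcomp : ι.comp α = αK.comp ι := RingHom.ext fun x => (extendQ_algebraMap p α x).symm
  have hcurve : (E.map α).map ι = (E.map ι).map αK := by rw [WeierstrassCurve.map_map, WeierstrassCurve.map_map, hcomp]
  have hΛmap : PowerSeries.map ι (PowerSeries.map α Λ) = PowerSeries.map αK (PowerSeries.map ι Λ) := by
    rw [map_map_apply, map_map_apply, hcomp]
  have hsT : HasSubst T := HasSubst.of_constantCoeff_zero' hT0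
  have hT0' : constantCoeff (PowerSeries.map ι T) = 0 := by
    rw [← coeff_zero_eq_constantCoeff_apply, coeff_map, coeff_zero_eq_constantCoeff_apply, hT0, map_zero]
  have hTω' : ((E.map ι).map αK).formalInvDiff.subst (PowerSeries.map ι T) *
      d⁄dX (completeRingQ p) (PowerSeries.map ι T) = C (ι π) * (E.map ι).formalInvDiff := by
    have h := congrArg (PowerSeries.map ι) hTω
    rw [map_mul, map_subst_apply hsT, ← derivative_map, (E.map α).map_formalInvDiff ι, hcurve,
      map_mul, map_C, E.map_formalInvDiff ι] at h
    exact h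
  have hQ' : ((p : PowerSeries (completeRingQ p)) * (E.map ι).zetaTilde (PowerSeries.map ι Λ) -
      C (ι π) * (((E.map ι).map αK).zetaTilde (PowerSeries.map αK (PowerSeries.map ι Λ))).subst
        (PowerSeries.map ι T)) * PowerSeries.map ι u =
      (E.map ι).formalInvariantDerivation (PowerSeries.map ι u) := by
    have h := congrArg (PowerSeries.map ι) hQ
    rw [map_mul, map_sub, map_mul, map_mul, map_natCast, E.map_zetaTilde ι, map_C,
      map_subst_apply hsT, (E.map α).map_zetaTilde ι, hcurve, hΛmap,
      WeierstrassCurve.formalInvariantDerivation_apply, map_mul, E.map_formalEta ι, ← derivative_map,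
      ← WeierstrassCurve.formalInvariantDerivation_apply] at h
    exact h
  -- Thm. 1 by Dwork's lemma over `K`
  refine (E.map ι).coeff_exp_sigmaExpArg_mem_of_isogeny p (intSubring p) αK
    (exists_pow_mul_mem_intSubring p) (fun r hr => extendQ_mem_intSubring p α hr)
    (fun r hr => exists_extendQ_eq_pow_add p α (frobeniusLift_sub_pow_mem p A'₄ A'₆ h₄ h₆) hr)
    (WeierstrassCurve.constantCoeff_map_eq_one ι h0) ?_ hT0' ?_ hTω'
    (WeierstrassCurve.constantCoeff_map_eq_one ι hu0) ?_ hQ' n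
  · rw [← E.map_zetaTilde ι, ← coeff_zero_eq_constantCoeff_apply, coeff_map]
    exact ⟨_, rfl⟩
  · intro n
    obtain ⟨b, hb, h⟩ := exists_mem_intSubring_of_sub_mem_span p (hT n)
    refine ⟨b, hb, ?_⟩
    rw [← hι] at h
    rw [coeff_map, h]
    split_ifs <;> simp
  · intro n
    obtain ⟨b, hb, h⟩ := exists_mem_intSubring_of_sub_mem_span p
      (show coeff (n + 1) u - 0 ∈ Ideal.span {(p : completeRing p)} by rw [sub_zero]; exact hu n)
    rw [← hι] at h
    exact ⟨b, hb, by rw [coeff_map, h, map_zero, zero_add]⟩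


/-- **`WeierstrassCurve.mazur_tate_sigma_existsUnique` (Mazur–Stein–Tate 2006, Thm. 1.3) from the
data of a Frobenius `p`-isogeny of the universal ordinary curve** — Blakestad–Grant's Thm. 1
assembled from their Prop. 13 (this file), Cor. 6(c), Thm. 2 and Thm. 15 (tree). For every
`p ≥ 5` suppose given, over `R̂ = completeRing p` with `𝓔 = universalCurve p`:
* `A'₄, A'₆ ∈ R̂` with `A'ᵢ ≡ Aᵢᵖ (mod p)` (Prop. 7(b): the coefficients of `𝓔' = 𝓔/𝒢` in the
  model `E'_{p/H}`), whence `α = frobeniusLift` (Def. 8) and `𝓔' = α_*𝓔`;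
* `T' ∈ zR̂⟦z⟧` with `T' ≡ zᵖ (mod p)` (Prop. 7(c): `t' = t_{p/H}`) and `ω'(T')dT' = πω`
  (`ψ^*ω' = (p/H)ω`);
* a unit series `u = 1 + O(z²)`, `u ≡ 1 (mod p)` (Lemma 12), and `T₀ ∈ R̂` (`= Σ'_{u∈G} x(u)`),
  satisfying the Vélu–Lemma 10 identity `x₁ = p x - Σ' x(u) - D(Dφ_ψ/φ_ψ)` in the pole-free form
  `(π²ρ'(T') - pρ + T₀)u² = uD²u - (Du)²` (`ρ = x + D(Dz/z)`, `formalXReg`; by Lemma 12,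
  `D² log φ_ψ(x(t)) = D² log(T't⁻ᵖu⁻¹)`).
Then the Mazur–Tate sigma function exists (and is unique) at every good ordinary prime `p ≥ 5` of
every elliptic curve over `ℚ`. [Blakestad–Grant 2023, Thm. 1 (proof), Prop. 7, Lemma 12,
Prop. 13; Mazur–Stein–Tate 2006, Thm. 1.3] [cite: BlakestadGrant2023, Thm. 1] -/
theorem mazur_tate_sigma_existsUnique_of_frobeniusIsogeny
    (H : ∀ (p : ℕ) [Fact p.Prime], 5 ≤ p →
      ∃ (A'₄ A'₆ : completeRing p) (h₄ : A'₄ - univA₄ p ^ p ∈ Ideal.span {(p : completeRing p)})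
        (h₆ : A'₆ - univA₆ p ^ p ∈ Ideal.span {(p : completeRing p)})
        (T u : PowerSeries (completeRing p)) (π T₀ : completeRing p),
        constantCoeff T = 0 ∧
        (∀ n, coeff n T - (if n = p then 1 else 0) ∈ Ideal.span {(p : completeRing p)}) ∧
        constantCoeff u = 1 ∧ coeff 1 u = 0 ∧
        (∀ n, coeff (n + 1) u ∈ Ideal.span {(p : completeRing p)}) ∧
        ((universalCurve p).map (frobeniusLift p A'₄ A'₆ h₄ h₆)).formalInvDiff.subst T *
            d⁄dX (completeRing p) T = C π * (universalCurve p).formalInvDiff ∧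
        (C (π ^ 2) * (((universalCurve p).map (frobeniusLift p A'₄ A'₆ h₄ h₆)).formalXReg).subst T -
            (p : PowerSeries (completeRing p)) * (universalCurve p).formalXReg + C T₀) * u ^ 2 =
          logDeriv₂Num (universalCurve p).formalInvariantDerivation u) :
    WeierstrassCurve.mazur_tate_sigma_existsUnique := by
  refine WeierstrassCurve.mazur_tate_sigma_existsUnique_of_universal_exp_sigmaExpArg_integral'
    fun p _ hp5 β Λ h0 hev hΛ => ?_
  obtain ⟨A'₄, A'₆, h₄, h₆, T, u, π, T₀, hT0, hT, hu0, hu1, hu, hTω, hB⟩ := H p hp5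
  exact coeff_exp_sigmaExpArg_universalCurve_mem p hp5 h₄ h₆ hT0 hT hu0 hu1 hu hTω hB h0 hev hΛ

/-- `ι = R̂ → K` is injective on power series (`p ≥ 5`). [folklore] -/
theorem powerSeries_map_algebraMap_injective (p : ℕ) [Fact p.Prime] (hp5 : 5 ≤ p) :
    Function.Injective (PowerSeries.map (algebraMap (completeRing p) (completeRingQ p))) :=
  PowerSeries.map_injective _ (algebraMap_completeRingQ_injective p hp5)

/-- **Per-prime form of `mazur_tate_sigma_existsUnique_of_frobeniusIsogeny'`** (identities over
`K = R̂[1/p]`, `π, T₀ ∈ K`): `exp(∫ζ̃ω) ∈ R̂⟦z⟧` for every even zeta series of `𝓔`.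
[Blakestad–Grant 2023, Thm. 1 (proof), Prop. 13] [cite: BlakestadGrant2023, Thm. 1] -/
theorem coeff_exp_sigmaExpArg_universalCurve_mem' (p : ℕ) [Fact p.Prime] (hp5 : 5 ≤ p)
    {A'₄ A'₆ : completeRing p} (h₄ : A'₄ - univA₄ p ^ p ∈ Ideal.span {(p : completeRing p)})
    (h₆ : A'₆ - univA₆ p ^ p ∈ Ideal.span {(p : completeRing p)})
    {T u : PowerSeries (completeRing p)} {π T₀ : completeRingQ p}
    (hT0 : constantCoeff T = 0)
    (hT : ∀ n, coeff n T - (if n = p then 1 else 0) ∈ Ideal.span {(p : completeRing p)})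
    (hu0 : constantCoeff u = 1) (hu1 : coeff 1 u = 0)
    (hu : ∀ n, coeff (n + 1) u ∈ Ideal.span {(p : completeRing p)})
    (hTω : (((universalCurve p).map (frobeniusLift p A'₄ A'₆ h₄ h₆)).map
        (algebraMap (completeRing p) (completeRingQ p))).formalInvDiff.subst
        (PowerSeries.map (algebraMap (completeRing p) (completeRingQ p)) T) *
      d⁄dX (completeRingQ p) (PowerSeries.map (algebraMap (completeRing p) (completeRingQ p)) T) =
      C π * ((universalCurve p).map (algebraMap (completeRing p) (completeRingQ p))).formalInvDiff)
    (hB : (C (π ^ 2) * ((((universalCurve p).map (frobeniusLift p A'₄ A'₆ h₄ h₆)).map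
        (algebraMap (completeRing p) (completeRingQ p))).formalXReg).subst
        (PowerSeries.map (algebraMap (completeRing p) (completeRingQ p)) T) -
        (p : PowerSeries (completeRingQ p)) *
          ((universalCurve p).map (algebraMap (completeRing p) (completeRingQ p))).formalXReg +
        C T₀) * PowerSeries.map (algebraMap (completeRing p) (completeRingQ p)) u ^ 2 =
      logDeriv₂Num ((universalCurve p).map
        (algebraMap (completeRing p) (completeRingQ p))).formalInvariantDerivation
        (PowerSeries.map (algebraMap (completeRing p) (completeRingQ p)) u))
    {β : completeRing p} {Λ : PowerSeries (completeRing p)} (h0 : constantCoeff Λ = 1)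
    (hev : rescale (-1 : completeRing p) Λ = Λ)
    (hΛ : X * d⁄dX (completeRing p) Λ - Λ =
      -(((universalCurve p).formalXMulSq - C β * X ^ 2) * (universalCurve p).formalInvDiff)) (n : ℕ) :
    coeff n ((exp (completeRingQ p)).subst
      (((universalCurve p).map (algebraMap (completeRing p) (completeRingQ p))).sigmaExpArg
        (PowerSeries.map (algebraMap (completeRing p) (completeRingQ p)) Λ))) ∈ intSubring p := by
  set ι := algebraMap (completeRing p) (completeRingQ p) with hι
  set E := universalCurve p with hE
  set E' := (universalCurve p).map (frobeniusLift p A'₄ A'₆ h₄ h₆) with hE'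
  have hinj := powerSeries_map_algebraMap_injective p hp5
  have hsT : HasSubst T := HasSubst.of_constantCoeff_zero' hT0
  have hT0' : constantCoeff (PowerSeries.map ι T) = 0 := by
    rw [← coeff_zero_eq_constantCoeff_apply, coeff_map, coeff_zero_eq_constantCoeff_apply, hT0, map_zero]
  -- `π = ι([z¹]T')`
  have hπ : π = ι (coeff 1 T) := by
    have h := congrArg constantCoeff hTω
    rw [map_mul, constantCoeff_subst_of_constantCoeff_eq_zero hT0', WeierstrassCurve.constantCoeff_formalInvDiff,
      one_mul, ← coeff_zero_eq_constantCoeff_apply, coeff_derivative, zero_add, Nat.cast_zero, zero_add,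
      mul_one, coeff_map, map_mul, WeierstrassCurve.constantCoeff_formalInvDiff, mul_one, constantCoeff_C] at h
    exact h.symm
  -- descend `ω'(T')dT' = πω`
  have hTωR : E'.formalInvDiff.subst T * d⁄dX (completeRing p) T = C (coeff 1 T) * E.formalInvDiff := by
    apply hinj
    rw [map_mul, map_subst_apply hsT, E'.map_formalInvDiff ι, ← derivative_map, map_mul, map_C,
      E.map_formalInvDiff ι, ← hπ]
    exact hTω
  -- descend the Vélu-level identity: `T₀ = ι(G(0))` for the `R̂`-series `G`
  set G : PowerSeries (completeRing p) := logDeriv₂Num E.formalInvariantDerivation u -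
    (C (coeff 1 T ^ 2) * (E'.formalXReg).subst T - (p : PowerSeries (completeRing p)) * E.formalXReg) * u ^ 2
    with hG
  have hmapD : ∀ f : PowerSeries (completeRing p), PowerSeries.map ι (E.formalInvariantDerivation f) =
      (E.map ι).formalInvariantDerivation (PowerSeries.map ι f) := fun f => by
    rw [WeierstrassCurve.formalInvariantDerivation_apply, WeierstrassCurve.formalInvariantDerivation_apply,
      map_mul, E.map_formalEta ι, derivative_map]
  have hmapL : PowerSeries.map ι (logDeriv₂Num E.formalInvariantDerivation u) =
      logDeriv₂Num (E.map ι).formalInvariantDerivation (PowerSeries.map ι u) := by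
    simp only [logDeriv₂Num_def, map_sub, map_mul, map_pow, hmapD]
  have hGmap : PowerSeries.map ι G = C T₀ * PowerSeries.map ι u ^ 2 := by
    have hB' := hB
    simp only [map_pow] at hB'
    rw [hG]
    simp only [map_sub, map_mul, map_pow, map_C, map_natCast, hmapL, map_subst_apply hsT,
      E'.map_formalXReg ι, E.map_formalXReg ι]
    rw [← hπ]
    linear_combination -hB'
  have hT₀ : T₀ = ι (constantCoeff G) := by
    have h := congrArg constantCoeff hGmap
    rw [← coeff_zero_eq_constantCoeff_apply, coeff_map, coeff_zero_eq_constantCoeff_apply, map_mul, map_pow,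
      ← coeff_zero_eq_constantCoeff_apply (PowerSeries.map ι u), coeff_map, coeff_zero_eq_constantCoeff_apply,
      hu0, map_one, one_pow, mul_one, constantCoeff_C] at h
    exact h.symm
  have hBR : (C (coeff 1 T ^ 2) * (E'.formalXReg).subst T - (p : PowerSeries (completeRing p)) * E.formalXReg +
      C (constantCoeff G)) * u ^ 2 = logDeriv₂Num E.formalInvariantDerivation u := by
    have hGC : G = C (constantCoeff G) * u ^ 2 := by
      apply hinj
      rw [hGmap, map_mul, map_C, map_pow, ← hT₀]
    have hG' := hG
    rw [hGC] at hG'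
    linear_combination hG'
  exact coeff_exp_sigmaExpArg_universalCurve_mem p hp5 h₄ h₆ hT0 hT hu0 hu1 hu hTωR hBR h0 hev hΛ n


/-- **The same criterion with the two identities checked over `K = R̂[1/p]`** (where the
computations with the kernel polynomial `φ_ψ/p` and the sums `Σ'_{Q∈𝒢} x(Q)ᵏ` of Vélu's formulas
take place): `T', u` are still `R̂`-series (Prop. 7(c), Lemma 12), but `π, T₀ ∈ K` are arbitrary and
`ω'(T')dT' = πω`, `(π²ρ'(T') - pρ + T₀)u² = uD²u - (Du)²` are required only after base change to
`K`. (Both descend: `π = [z¹]T'`, and `T₀ = [z⁰]` of an `R̂`-series.)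
[Blakestad–Grant 2023, Thm. 1 (proof), Prop. 7, Lemma 12, Prop. 13] [cite: BlakestadGrant2023, Thm. 1] -/
theorem mazur_tate_sigma_existsUnique_of_frobeniusIsogeny'
    (H : ∀ (p : ℕ) [Fact p.Prime], 5 ≤ p →
      ∃ (A'₄ A'₆ : completeRing p) (h₄ : A'₄ - univA₄ p ^ p ∈ Ideal.span {(p : completeRing p)})
        (h₆ : A'₆ - univA₆ p ^ p ∈ Ideal.span {(p : completeRing p)})
        (T u : PowerSeries (completeRing p)) (π T₀ : completeRingQ p),
        constantCoeff T = 0 ∧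
        (∀ n, coeff n T - (if n = p then 1 else 0) ∈ Ideal.span {(p : completeRing p)}) ∧
        constantCoeff u = 1 ∧ coeff 1 u = 0 ∧
        (∀ n, coeff (n + 1) u ∈ Ideal.span {(p : completeRing p)}) ∧
        (((universalCurve p).map (frobeniusLift p A'₄ A'₆ h₄ h₆)).map
            (algebraMap (completeRing p) (completeRingQ p))).formalInvDiff.subst
            (PowerSeries.map (algebraMap (completeRing p) (completeRingQ p)) T) *
          d⁄dX (completeRingQ p) (PowerSeries.map (algebraMap (completeRing p) (completeRingQ p)) T) =
          C π * ((universalCurve p).map (algebraMap (completeRing p) (completeRingQ p))).formalInvDiff ∧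
        (C (π ^ 2) * ((((universalCurve p).map (frobeniusLift p A'₄ A'₆ h₄ h₆)).map
            (algebraMap (completeRing p) (completeRingQ p))).formalXReg).subst
            (PowerSeries.map (algebraMap (completeRing p) (completeRingQ p)) T) -
            (p : PowerSeries (completeRingQ p)) *
              ((universalCurve p).map (algebraMap (completeRing p) (completeRingQ p))).formalXReg +
            C T₀) * PowerSeries.map (algebraMap (completeRing p) (completeRingQ p)) u ^ 2 =
          logDeriv₂Num ((universalCurve p).map
            (algebraMap (completeRing p) (completeRingQ p))).formalInvariantDerivation
            (PowerSeries.map (algebraMap (completeRing p) (completeRingQ p)) u)) :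
    WeierstrassCurve.mazur_tate_sigma_existsUnique := by
  refine WeierstrassCurve.mazur_tate_sigma_existsUnique_of_universal_exp_sigmaExpArg_integral'
    fun p _ hp5 β Λ h0 hev hΛ => ?_
  obtain ⟨A'₄, A'₆, h₄, h₆, T, u, π, T₀, hT0, hT, hu0, hu1, hu, hTω, hB⟩ := H p hp5
  exact coeff_exp_sigmaExpArg_universalCurve_mem' p hp5 h₄ h₆ hT0 hT hu0 hu1 hu hTω hB h0 hev hΛ

end Literature.NumberTheory.EllipticCurves.UniversalOrdinary

/-! ### From Vélu's formula (with Lemma 10) to the hypothesis of Prop. 13(a) -/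

namespace WeierstrassCurve

section Velu

variable {K : Type*} [CommRing K]

/-- `logDeriv₂Num D z = zηη' - η²` (`D² log z = D(η/z)`). [folklore] -/
theorem logDeriv₂Num_formalInvariantDerivation_X (W : WeierstrassCurve K) :
    logDeriv₂Num W.formalInvariantDerivation (X : K⟦X⟧) =
      X * W.formalEta * d⁄dX K W.formalEta - W.formalEta ^ 2 := by
  rw [logDeriv₂Num_def, formalInvariantDerivation_X, formalInvariantDerivation_apply]
  ring

/-- **`π²T'²·ρ'(T') = π²X'(T') + logDeriv₂Num D T'`** — the regular part of `x'` read through the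
isogeny: `ρ'(T') = x'(T') + [D'(D'τ/τ)](T') = X'(T')/T'² + π⁻²D² log T'` (chain rule twice, using
`ω'(T')dT' = πω`). [Blakestad–Grant 2023, proof of Prop. 13 (the terms `D't'/t'`)] [folklore] -/
theorem sq_mul_formalXReg_subst {W W' : WeierstrassCurve K} {T : K⟦X⟧} {π : K}
    (hT0 : constantCoeff T = 0)
    (hTω : W'.formalInvDiff.subst T * d⁄dX K T = C π * W.formalInvDiff) :
    C π ^ 2 * T ^ 2 * W'.formalXReg.subst T =
      C π ^ 2 * W'.formalXMulSq.subst T + logDeriv₂Num W.formalInvariantDerivation T := by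
  have hs : HasSubst T := HasSubst.of_constantCoeff_zero' hT0
  have hc := W.formalEta_mul_derivative_of_formalInvDiff_subst hT0 hTω
  -- `(a')` substituted: `T²ρ'(T) = X'(T) + T η'(T) η'^•(T) - η'(T)²`
  have ha : T ^ 2 * W'.formalXReg.subst T = W'.formalXMulSq.subst T +
      T * W'.formalEta.subst T * (d⁄dX K W'.formalEta).subst T - W'.formalEta.subst T ^ 2 := by
    have h := congrArg (PowerSeries.subst T) W'.X_sq_mul_formalXReg
    rw [formalXRegNum, subst_mul hs, subst_pow hs, subst_X hs, subst_sub hs, subst_add hs, subst_mul hs,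
      subst_mul hs, subst_X hs, subst_pow hs] at h
    exact h
  -- `D T = π η'(T)` and `D(DT) = π² η'(T) η'^•(T)`
  have hD1 : W.formalInvariantDerivation T = C π * W'.formalEta.subst T := by
    rw [formalInvariantDerivation_apply, hc]
  have hD2 : W.formalInvariantDerivation (W.formalInvariantDerivation T) =
      C π ^ 2 * (W'.formalEta.subst T * (d⁄dX K W'.formalEta).subst T) := by
    rw [hD1, W.formalInvariantDerivation_C_mul, formalInvariantDerivation_apply, derivative_subst K hs]
    linear_combination (C π * (d⁄dX K W'.formalEta).subst T) * hc
  rw [logDeriv₂Num_def, hD2, hD1]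
  linear_combination C π ^ 2 * ha

/-- **The hypothesis of `zetaTilde_isogeny_rel_of_formalXReg_rel` from Vélu's formula.** Vélu
(1971): the quotient `E → E' = E/𝒢` by a finite subgroup of odd order `p`, in the model with
`ψ^*ω₁ = ω`, has `x₁∘ψ = x + Σ'_{Q∈𝒢}(x∘τ_Q - x(Q))`; with Blakestad–Grant's Lemma 10
(`x∘τ_Q + x∘τ_{-Q} = 2x - D² log(x - x(Q))`) this is `x₁∘ψ = p·x - D² log Π_{±Q}(x - x(Q)) - T₀`,
`T₀ = Σ' x(Q)` (their eq. (7)); in the model `E'_π` (`ψ^*ω' = πω`, `x₁ = π²x'`) and with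
`N = t^{p-1}Π_{±Q}(x(t) - x(Q)) = Π(X - x(Q)t²)` (`N(0) = 1`), `T' = π·t·N·u` (Lemma 12), the
identity multiplied by `t²N²u²` is the pole-free hypothesis `hV`:
`X'(T') = (p·X·N² + (p-1)(zηη' - η²)N² - z²·(N D²N - (DN)²) - T₀z²N²)·u²`
(`D² log(t^{1-p}N) = (1-p)D(η/t) + D² log N`). CONCLUSION: the `ρ`-form
`(π²ρ'(T') - pρ + T₀)u² = uD²u - (Du)²` (since both say `D² log(T'/(tN)) = D² log u`).
[Blakestad–Grant 2023, Lemmas 10–12, eq. (7); J. Vélu, C. R. Acad. Sci. Paris 273 (1971)]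
[cite: BlakestadGrant2023, Prop. 13] -/
theorem formalXReg_rel_of_velu {W W' : WeierstrassCurve K} {T N u : K⟦X⟧} {π T₀ : K} (p : ℕ)
    (hπ : IsUnit π) (hN0 : constantCoeff N = 1) (hu0 : constantCoeff u = 1)
    (hTu : T = C π * X * N * u)
    (hTω : W'.formalInvDiff.subst T * d⁄dX K T = C π * W.formalInvDiff)
    (hV : W'.formalXMulSq.subst T =
      ((p : K⟦X⟧) * W.formalXMulSq * N ^ 2 +
        ((p : K⟦X⟧) - 1) * (X * W.formalEta * d⁄dX K W.formalEta - W.formalEta ^ 2) * N ^ 2 -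
        X ^ 2 * logDeriv₂Num W.formalInvariantDerivation N - C T₀ * X ^ 2 * N ^ 2) * u ^ 2) :
    (C (π ^ 2) * W'.formalXReg.subst T - (p : K⟦X⟧) * W.formalXReg + C T₀) * u ^ 2 =
      logDeriv₂Num W.formalInvariantDerivation u := by
  have hT0 : constantCoeff T = 0 := by
    rw [hTu, map_mul, map_mul, map_mul, constantCoeff_X, mul_zero, zero_mul, zero_mul]
  have h1 := sq_mul_formalXReg_subst (W := W) hT0 hTω
  have ha := W.X_sq_mul_formalXReg
  rw [formalXRegNum] at ha
  have hLX := W.logDeriv₂Num_formalInvariantDerivation_X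
  -- `L(T) = π²L(z)N²u² + π²z²(L(N)u² + N²L(u))`
  have hLT : logDeriv₂Num W.formalInvariantDerivation T =
      C π ^ 2 * ((X * W.formalEta * d⁄dX K W.formalEta - W.formalEta ^ 2) * (N * u) ^ 2 +
        X ^ 2 * (logDeriv₂Num W.formalInvariantDerivation N * u ^ 2 +
          N ^ 2 * logDeriv₂Num W.formalInvariantDerivation u)) := by
    rw [hTu, show C π * X * N * u = C π * (X * (N * u)) by ring,
      logDeriv₂Num_const_mul _ (W.formalInvariantDerivation_C π), logDeriv₂Num_mul, logDeriv₂Num_mul, hLX]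
  -- the identity multiplied by `T² = π²z²N²u²`
  have hT2 : T ^ 2 = C π ^ 2 * X ^ 2 * N ^ 2 * u ^ 2 := by rw [hTu]; ring
  rw [hT2] at h1
  have hmain : (C π ^ 2 * N ^ 2 * u ^ 2) * (X ^ 2 *
      ((C (π ^ 2) * W'.formalXReg.subst T - (p : K⟦X⟧) * W.formalXReg + C T₀) * u ^ 2)) =
      (C π ^ 2 * N ^ 2 * u ^ 2) * (X ^ 2 * logDeriv₂Num W.formalInvariantDerivation u) := by
    simp only [map_pow]
    linear_combination u ^ 2 * h1 + (C π ^ 2 * u ^ 2) * hV + u ^ 2 * hLT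
      - (C π ^ 2 * N ^ 2 * u ^ 4 * (p : K⟦X⟧)) * ha
  -- cancel `(πNu)²` (a unit) and `z²`
  have hunit : IsUnit (C π ^ 2 * N ^ 2 * u ^ 2 : K⟦X⟧) := by
    rw [PowerSeries.isUnit_iff_constantCoeff, map_mul, map_mul, map_pow, map_pow, map_pow, hN0, hu0, one_pow,
      mul_one, mul_one, constantCoeff_C]
    exact hπ.pow 2
  exact eq_of_X_sq_mul_eq (hunit.mul_right_injective hmain)

end Velu

end WeierstrassCurve

/-! ### Assembly from Vélu-level data -/

namespace Literature.NumberTheory.EllipticCurves.UniversalOrdinary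

/-- **`mazur_tate_sigma_existsUnique` from Vélu-level data of the canonical `p`-isogeny.** For every
`p ≥ 5`, over `R̂ = completeRing p`, `K = R̂[1/p]`, `𝓔 = universalCurve p`, suppose given:
`A'₄, A'₆ ∈ R̂` with `A'ᵢ ≡ Aᵢᵖ (mod p)` (Prop. 7(b); `α = frobeniusLift`, `𝓔' = α_*𝓔`);
`T' ∈ R̂⟦t⟧` with `T' ≡ tᵖ (mod p)` (Prop. 7(c)) and `u ∈ 1 + t²R̂⟦t⟧`, `u ≡ 1 (mod p)`
(Lemma 12); over `K`: a unit `π` (`= p/H`), `N = Π_{±Q∈𝒢∖O}(X - x(Q)t²) = t^{p-1}φ_ψ(x(t))/p`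
(`N(0) = 1`), `T₀ = Σ'_{Q∈𝒢} x(Q)`, with `T' = π·t·N·u` (Lemma 12), `ω'(T')dT' = πω`
(`ψ^*ω' = (p/H)ω`), and Vélu's formula summed with Lemma 10,
`π²x'(T') = p·x - D² log(t^{1-p}N) - T₀`, in the pole-free form `hV` of `formalXReg_rel_of_velu`.
Then the named fact holds. [Blakestad–Grant 2023, Thm. 1, Prop. 7, Lemmas 10–12, Prop. 13;
J. Vélu, C. R. Acad. Sci. Paris 273 (1971); Mazur–Stein–Tate 2006, Thm. 1.3]
[cite: BlakestadGrant2023, Thm. 1] -/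
theorem mazur_tate_sigma_existsUnique_of_velu
    (H : ∀ (p : ℕ) [Fact p.Prime], 5 ≤ p →
      ∃ (A'₄ A'₆ : completeRing p) (h₄ : A'₄ - univA₄ p ^ p ∈ Ideal.span {(p : completeRing p)})
        (h₆ : A'₆ - univA₆ p ^ p ∈ Ideal.span {(p : completeRing p)})
        (T u : PowerSeries (completeRing p)) (N : PowerSeries (completeRingQ p)) (π T₀ : completeRingQ p),
        IsUnit π ∧
        (∀ n, coeff n T - (if n = p then 1 else 0) ∈ Ideal.span {(p : completeRing p)}) ∧
        constantCoeff u = 1 ∧ coeff 1 u = 0 ∧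
        (∀ n, coeff (n + 1) u ∈ Ideal.span {(p : completeRing p)}) ∧
        constantCoeff N = 1 ∧
        PowerSeries.map (algebraMap (completeRing p) (completeRingQ p)) T =
          C π * X * N * PowerSeries.map (algebraMap (completeRing p) (completeRingQ p)) u ∧
        (((universalCurve p).map (frobeniusLift p A'₄ A'₆ h₄ h₆)).map
            (algebraMap (completeRing p) (completeRingQ p))).formalInvDiff.subst
            (PowerSeries.map (algebraMap (completeRing p) (completeRingQ p)) T) *
          d⁄dX (completeRingQ p) (PowerSeries.map (algebraMap (completeRing p) (completeRingQ p)) T) =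
          C π * ((universalCurve p).map (algebraMap (completeRing p) (completeRingQ p))).formalInvDiff ∧
        (((universalCurve p).map (frobeniusLift p A'₄ A'₆ h₄ h₆)).map
            (algebraMap (completeRing p) (completeRingQ p))).formalXMulSq.subst
            (PowerSeries.map (algebraMap (completeRing p) (completeRingQ p)) T) =
          ((p : PowerSeries (completeRingQ p)) *
              ((universalCurve p).map (algebraMap (completeRing p) (completeRingQ p))).formalXMulSq * N ^ 2 +
            ((p : PowerSeries (completeRingQ p)) - 1) *
              (X * ((universalCurve p).map (algebraMap (completeRing p) (completeRingQ p))).formalEta *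
                d⁄dX (completeRingQ p)
                  ((universalCurve p).map (algebraMap (completeRing p) (completeRingQ p))).formalEta -
                ((universalCurve p).map (algebraMap (completeRing p) (completeRingQ p))).formalEta ^ 2) * N ^ 2 -
            X ^ 2 * logDeriv₂Num ((universalCurve p).map
              (algebraMap (completeRing p) (completeRingQ p))).formalInvariantDerivation N -
            C T₀ * X ^ 2 * N ^ 2) *
          PowerSeries.map (algebraMap (completeRing p) (completeRingQ p)) u ^ 2) :
    WeierstrassCurve.mazur_tate_sigma_existsUnique := by
  refine WeierstrassCurve.mazur_tate_sigma_existsUnique_of_universal_exp_sigmaExpArg_integral'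
    fun p _ hp5 β Λ h0 hev hΛ => ?_
  obtain ⟨A'₄, A'₆, h₄, h₆, T, u, N, π, T₀, hπ, hT, hu0, hu1, hu, hN0, hTu, hTω, hV⟩ := H p hp5
  have hu0' : constantCoeff (PowerSeries.map (algebraMap (completeRing p) (completeRingQ p)) u) = 1 :=
    WeierstrassCurve.constantCoeff_map_eq_one _ hu0
  have hT0 : constantCoeff T = 0 := by
    apply algebraMap_completeRingQ_injective p hp5
    have h := congrArg constantCoeff hTu
    rw [map_mul, map_mul, map_mul, constantCoeff_X, mul_zero, zero_mul, zero_mul,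
      ← coeff_zero_eq_constantCoeff_apply, coeff_map, coeff_zero_eq_constantCoeff_apply] at h
    rw [h, map_zero]
  have hB := WeierstrassCurve.formalXReg_rel_of_velu p hπ hN0 hu0' hTu hTω hV
  exact coeff_exp_sigmaExpArg_universalCurve_mem' p hp5 h₄ h₆ hT0 hT hu0 hu1 hu hTω hB h0 hev hΛ

end Literature.NumberTheory.EllipticCurves.UniversalOrdinary
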